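import Summits.ResolutionOfSingularities.ResolutionOfSingularities.Theorems.ValuativeLuAlphaPTorsorAbhyankarDefectless
import Summits.ResolutionOfSingularities.ResolutionOfSingularities.Theorems.ValuativeLuAlphaPTorsorTorsorExtension
import Summits.ResolutionOfSingularities.ResolutionOfSingularities.Theorems.ValuativeLuAlphaPTorsorBestApproximation
import Summits.ResolutionOfSingularities.ResolutionOfSingularities.Theorems.ValuativeLuAlphaPTorsorDimTwoDefectless
import Mathlib.FieldTheory.IntermediateField.Adjoin.Algebra
import Mathlib.RingTheory.Adjoin.Polynomial.Basic
import Mathlib.Algebra.Polynomial.RingDivision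

/-!
# No residue exit along an Abhyankar place: the residue field of `K` is that of `K₀`

Crux `Valuative.LuAlphaPTorsor` (item `stmt-ResolutionOfSingularities-0641`), line
`pfaff-line-log-final-forms`, registered stub `stub_abhyankarSepOfNotResidue` (W2 of reshape v5).

Setting: `k` a field of characteristic `p`, `K ⊇ k` a field, `O` a valuation ring of `K`,
`A₀ ⊆ O` a finitely generated `k`-subalgebra, regular at the centre, `t ∈ K` with `t ^ p ∈ A₀`
and `Frac (A₀[t]) = K`; `K₀ := Frac A₀ = Subfield.closure A₀` (same carrier as
`IntermediateField.adjoin k A₀`, `torsorExtension_finite_unique`).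

**Claim** (`stub_abhyankarSepOfNotResidue`). If `O` is an Abhyankar place of `K/k`, the residue
field extension `κ(O ∩ K₀) / κ(k)` is separably generated, NO `K₀`-affine normalisation
`(t - c)/g` (`c, g ∈ K₀`) of `t` is a unit of `O` whose residue lies outside `κ(O ∩ K₀)`, and
`t ^ p` is not a `p`-th power in the local ring of the centre, then the residue field extension
`κ(O) / κ(k)` is separably generated — indeed `κ(O) = κ(O ∩ K₀)`.

Proof.
1. `K/K₀` is defectless along an Abhyankar place (`isDefectlessIn_torsor_of_isAbhyankarPlace`,
   Kuhlmann's generalized stability theorem) and unibranched (`torsorExtension_finite_unique`),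
   so `t` has a best approximation `c₀ ∈ K₀`
   (`exists_forall_valuation_sub_le_of_isDefectlessIn`).
2. `t ∉ K₀` (`dimTwo_not_mem_closure_of_forall_ne_pow`: the local ring of the centre is regular,
   hence normal, and `t ^ p` is not a `p`-th power there), so `u := t - c₀ ≠ 0`.
3. `ν(u) ∉ ν(K₀ˣ)`: if `ν(u) = ν(g)` with `0 ≠ g ∈ K₀`, then `(t - c₀)/g` is a unit of `O` and,
   `c₀` being a best approximation, no `z ∈ K₀` has `ν((t - c₀)/g - z) > 0`
   (`dimTwo_residue_hyp_of_best`) — a residue exit, excluded by hypothesis.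
4. `K = K₀(u)` with `u ^ p ∈ K₀`, so every `a ∈ K` is `∑_{i<p} aᵢ uⁱ` with `aᵢ ∈ K₀` (division
   with remainder by `X ^ p - u ^ p`). The non-zero terms have pairwise distinct values: a
   coincidence `ν(aᵢ uⁱ) = ν(aⱼ uʲ)`, `i < j < p`, puts `ν(u)^(j-i)` in `ν(K₀ˣ)`, and with
   `ν(u)^p ∈ ν(K₀ˣ)` and `gcd(j - i, p) = 1` this forces `ν(u) ∈ ν(K₀ˣ)`, contradicting 3. Hence
   `ν(a) = max ν(aᵢ uⁱ)` (`valuation_sum_eq_sup_of_pairwise_ne`); for `a ∈ O` all terms lie in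
   `O`, the terms with `i ≠ 0` cannot be units (same coprimality argument), so `a ≡ a₀` modulo
   `𝔪_O` and the residue of `a` is the residue of `a₀ ∈ O ∩ K₀`.
5. So `resField O ⊤ = resField O K₀`, and the hypothesis on `K₀` is the claim.
-/

-- single-problem summit: the doubled namespace component `ResolutionOfSingularities` is forced
set_option linter.dupNamespace false

namespace Summit.ResolutionOfSingularities.ResolutionOfSingularities.Theorems.PfaffLine

open IsLocalRing Literature.AlgebraicGeometry.Resolution Polynomial

section Helpers

variable {K : Type} [Field K] (O : ValuationSubring K) (F : Subfield K)

/-- **Coprime exponents.** If `ν(u ^ p)` and `ν(u ^ n)` are values of elements of a subfield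
`F`, with `p` prime and `0 < n < p`, then so is `ν(u)` (Bezout: `n·m = p·q + 1`). [folklore] -/
theorem sepNotRes_exists_valuation_eq_of_pow {p n : ℕ} (hp : p.Prime) (hn0 : 0 < n)
    (hnp : n < p) {u : K} (hu : u ≠ 0)
    (hpF : ∃ g ∈ F, O.valuation (u ^ p) = O.valuation g)
    (hnF : ∃ g ∈ F, O.valuation (u ^ n) = O.valuation g) :
    ∃ g ∈ F, O.valuation u = O.valuation g := by
  obtain ⟨g₁, hg₁, hv₁⟩ := hnF
  obtain ⟨g₂, hg₂, hv₂⟩ := hpF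
  have hcop : Nat.Coprime n p :=
    (hp.coprime_iff_not_dvd.mpr (Nat.not_dvd_of_pos_of_lt hn0 hnp)).symm
  obtain ⟨m, -, hm⟩ := Nat.exists_mul_mod_eq_one_of_coprime hcop hp.one_lt
  have hnm : n * m = p * (n * m / p) + 1 := by
    have h := Nat.div_add_mod (n * m) p
    omega
  have hg₂0 : g₂ ≠ 0 := by
    rintro rfl
    rw [Valuation.map_zero, Valuation.zero_iff] at hv₂
    exact pow_ne_zero _ hu hv₂
  refine ⟨g₁ ^ m / g₂ ^ (n * m / p), div_mem (pow_mem hg₁ m) (pow_mem hg₂ _), ?_⟩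
  have key : u ^ (n * m) = u ^ (p * (n * m / p)) * u := by
    rw [← pow_succ, ← hnm]
  have h1 : O.valuation (u ^ (n * m)) = O.valuation (g₁ ^ m) := by
    rw [pow_mul, Valuation.map_pow, hv₁, ← Valuation.map_pow]
  have h2 : O.valuation (u ^ (p * (n * m / p))) = O.valuation (g₂ ^ (n * m / p)) := by
    rw [pow_mul, Valuation.map_pow, hv₂, ← Valuation.map_pow]
  have hg₂q : O.valuation (g₂ ^ (n * m / p)) ≠ 0 :=
    (Valuation.ne_zero_iff _).mpr (pow_ne_zero _ hg₂0)
  rw [Valuation.map_div, ← h1, key, Valuation.map_mul, h2, mul_div_cancel_left₀ _ hg₂q]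

/-- **Distinct values of the terms `a uⁱ`.** If `ν(u)` is not the value of an element of the
subfield `F` but `ν(u ^ p)` is (`p` prime), then for `a, b ∈ F`, `b ≠ 0`, and exponents
`i < j < p` the values `ν(a uⁱ)` and `ν(b uʲ)` differ. [folklore] -/
theorem sepNotRes_valuation_mul_pow_ne {p : ℕ} (hp : p.Prime) {u : K} (hu : u ≠ 0)
    (hpF : ∃ g ∈ F, O.valuation (u ^ p) = O.valuation g)
    (hval : ∀ z ∈ F, O.valuation u ≠ O.valuation z)
    {a b : K} (ha : a ∈ F) (hb : b ∈ F) (hb0 : b ≠ 0)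
    {i j : ℕ} (hij : i < j) (hjp : j < p) :
    O.valuation (a * u ^ i) ≠ O.valuation (b * u ^ j) := by
  intro heq
  have hn0 : 0 < j - i := Nat.sub_pos_of_lt hij
  have hnp : j - i < p := lt_of_le_of_lt (Nat.sub_le j i) hjp
  have hj : j = i + (j - i) := by omega
  rw [hj, pow_add, Valuation.map_mul, Valuation.map_mul, Valuation.map_mul,
    mul_left_comm] at heq
  -- `heq : ν a · ν uⁱ = ν uⁱ · (ν b · ν u^(j-i))`
  have hui : O.valuation (u ^ i) ≠ 0 := (Valuation.ne_zero_iff _).mpr (pow_ne_zero _ hu)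
  have hvb : O.valuation b ≠ 0 := (Valuation.ne_zero_iff _).mpr hb0
  rw [mul_comm (O.valuation (u ^ i))] at heq
  have heq' : O.valuation a = O.valuation b * O.valuation (u ^ (j - i)) :=
    mul_right_cancel₀ hui heq
  have h2 : O.valuation (u ^ (j - i)) = O.valuation (a / b) := by
    rw [Valuation.map_div, eq_div_iff hvb, mul_comm]
    exact heq'.symm
  obtain ⟨g, hg, hvg⟩ :=
    sepNotRes_exists_valuation_eq_of_pow O F hp hn0 hnp hu hpF ⟨a / b, div_mem ha hb, h2⟩
  exact hval g hg hvg

/-- **Residues come from the constant term.** If `ν(u) ∉ ν(Fˣ)`, `ν(u ^ p) ∈ ν(Fˣ)` (`p` prime)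
and `a ∈ O` is `∑_{i<p} aᵢ uⁱ` with `aᵢ ∈ F`, then the residue of `a` is the residue of
`a₀ ∈ O ∩ F`: the non-zero terms have pairwise distinct values, so all of them lie in `O`
(`valuation_sum_eq_sup_of_pairwise_ne`) and those with `i ≠ 0` in `𝔪_O`. [folklore] -/
theorem sepNotRes_residue_mem_resField {p : ℕ} (hp : p.Prime) {u : K} (hu : u ≠ 0)
    (hpF : ∃ g ∈ F, O.valuation (u ^ p) = O.valuation g)
    (hval : ∀ z ∈ F, O.valuation u ≠ O.valuation z)
    (coef : Fin p → K) (hcoef : ∀ i, coef i ∈ F) (a : O)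
    (ha : (a : K) = ∑ i, coef i * u ^ (i : ℕ)) :
    residue O a ∈ resField O F := by
  classical
  haveI : NeZero p := ⟨hp.ne_zero⟩
  -- pairwise distinct values of the non-zero terms
  have hne : ∀ i i' : Fin p, i ≠ i' → coef i * u ^ (i : ℕ) ≠ 0 → coef i' * u ^ (i' : ℕ) ≠ 0 →
      O.valuation (coef i * u ^ (i : ℕ)) ≠ O.valuation (coef i' * u ^ (i' : ℕ)) := by
    intro i i' hii' hi hi'
    have hc : coef i ≠ 0 := fun h => hi (by rw [h, zero_mul])
    have hc' : coef i' ≠ 0 := fun h => hi' (by rw [h, zero_mul])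
    rcases lt_or_gt_of_ne (fun h : (i : ℕ) = i' => hii' (Fin.ext h)) with hlt | hlt
    · exact sepNotRes_valuation_mul_pow_ne O F hp hu hpF hval (hcoef i) (hcoef i') hc' hlt
        i'.isLt
    · exact (sepNotRes_valuation_mul_pow_ne O F hp hu hpF hval (hcoef i') (hcoef i) hc hlt
        i.isLt).symm
  have hsum : O.valuation (a : K) =
      Finset.univ.sup fun i : Fin p => O.valuation (coef i * u ^ (i : ℕ)) := by
    rw [ha]
    exact valuation_sum_eq_sup_of_pairwise_ne O (fun i : Fin p => coef i * u ^ (i : ℕ)) hne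
  have hle : ∀ i : Fin p, O.valuation (coef i * u ^ (i : ℕ)) ≤ 1 := fun i =>
    calc O.valuation (coef i * u ^ (i : ℕ))
        ≤ Finset.univ.sup fun i : Fin p => O.valuation (coef i * u ^ (i : ℕ)) :=
          Finset.le_sup (f := fun i : Fin p => O.valuation (coef i * u ^ (i : ℕ)))
            (Finset.mem_univ i)
      _ = O.valuation (a : K) := hsum.symm
      _ ≤ 1 := (O.valuation_le_one_iff _).mpr a.2
  -- the terms with `i ≠ 0` lie in the maximal ideal
  have hlt : ∀ i : Fin p, i ≠ 0 → O.valuation (coef i * u ^ (i : ℕ)) < 1 := by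
    intro i hi0
    refine lt_of_le_of_ne (hle i) fun h1 => ?_
    have hc : coef i ≠ 0 := by
      intro h
      rw [h, zero_mul, Valuation.map_zero] at h1
      exact zero_ne_one h1
    have hipos : 0 < (i : ℕ) := Nat.pos_of_ne_zero fun h => hi0 (Fin.ext (by rw [h, Fin.val_zero]))
    refine sepNotRes_valuation_mul_pow_ne O F hp hu hpF hval (one_mem F) (hcoef i) hc hipos
      i.isLt ?_
    rw [pow_zero, mul_one, Valuation.map_one]
    exact h1.symm
  -- `a ≡ a₀ (mod 𝔪_O)`
  have hx0 : coef 0 * u ^ ((0 : Fin p) : ℕ) = coef 0 := by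
    rw [Fin.val_zero, pow_zero, mul_one]
  have hdiff : O.valuation ((a : K) - coef 0) < 1 := by
    have h : (a : K) - coef 0 = ∑ i ∈ Finset.univ.erase (0 : Fin p), coef i * u ^ (i : ℕ) := by
      rw [ha, ← Finset.sum_erase_add _ _ (Finset.mem_univ (0 : Fin p)), hx0, add_sub_cancel_right]
    rw [h]
    exact Valuation.map_sum_lt _ one_ne_zero fun i hi => hlt i (Finset.ne_of_mem_erase hi)
  have hc0O : coef 0 ∈ O := by
    rw [← O.valuation_le_one_iff, ← hx0]
    exact hle 0
  refine (mem_resField_iff O F _).mpr ⟨⟨coef 0, hc0O⟩, hcoef 0, ?_⟩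
  rw [← sub_eq_zero, ← map_sub, residue_eq_zero_iff, ValuationSubring.valuation_lt_one_iff]
  change O.valuation (coef 0 - (a : K)) < 1
  rw [Valuation.map_sub_swap]
  exact hdiff

/-- **Expansion in powers of a radical generator.** If `u ^ n ∈ F` (`n ≠ 0`), every element of
`F(u)` is `∑_{i<n} cᵢ uⁱ` with `cᵢ ∈ F` (division with remainder by `X ^ n - u ^ n`).
[folklore] -/
theorem sepNotRes_exists_sum_eq {F E : Type} [Field F] [Field E] [Algebra F E] {n : ℕ}
    (hn : n ≠ 0) (u : E) (b : F) (hb : algebraMap F E b = u ^ n) (a : E)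
    (ha : a ∈ IntermediateField.adjoin F {u}) :
    ∃ coef : Fin n → F, a = ∑ i, algebraMap F E (coef i) * u ^ (i : ℕ) := by
  have hint : IsIntegral F u :=
    IsIntegral.of_pow (Nat.pos_of_ne_zero hn) (by rw [← hb]; exact isIntegral_algebraMap)
  rw [← IntermediateField.mem_toSubalgebra,
    IntermediateField.adjoin_simple_toSubalgebra_of_isAlgebraic hint.isAlgebraic,
    Algebra.adjoin_singleton_eq_range_aeval, AlgHom.mem_range] at ha
  obtain ⟨f, rfl⟩ := ha
  have hqm : (X ^ n - C b : F[X]).Monic := monic_X_pow_sub_C b hn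
  have hq1 : (X ^ n - C b : F[X]) ≠ 1 := by
    intro h
    have h' := congrArg natDegree h
    rw [natDegree_X_pow_sub_C, natDegree_one] at h'
    exact hn h'
  have hqu : aeval u (X ^ n - C b : F[X]) = 0 := by
    rw [map_sub, map_pow, aeval_X, aeval_C, hb, sub_self]
  have hdeg : (f %ₘ (X ^ n - C b)).natDegree < n := by
    have h := natDegree_modByMonic_lt f hqm hq1
    rwa [natDegree_X_pow_sub_C] at h
  refine ⟨fun i => (f %ₘ (X ^ n - C b)).coeff i, ?_⟩
  rw [← aeval_modByMonic_eq_self_of_root (p := f) hqu, aeval_eq_sum_range' hdeg, Finset.sum_range]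
  simp only [Algebra.smul_def]

end Helpers

/-- **No residue exit along an Abhyankar place ⇒ the residue field of `K` is that of `K₀`**
(registered stub `stub_abhyankarSepOfNotResidue`, W2 of reshape v5 of line
`pfaff-line-log-final-forms`). Along an Abhyankar place of `K/k` the torsor extension `K/K₀`,
`K₀ = Frac A₀`, is defectless (`isDefectlessIn_torsor_of_isAbhyankarPlace`) and unibranched
(`torsorExtension_finite_unique`), so `t` has a best approximation `c₀ ∈ K₀`
(`exists_forall_valuation_sub_le_of_isDefectlessIn`); `t ∉ K₀` as `t ^ p` is not a `p`-th power
at the (normal) centre (`dimTwo_not_mem_closure_of_forall_ne_pow`); with no residue exit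
available, `ν(t - c₀) ∉ ν(K₀ˣ)` (`dimTwo_residue_hyp_of_best`), and then every unit of `O`,
expanded as `∑_{i<p} aᵢ (t - c₀)^i` with `aᵢ ∈ K₀`, has pairwise distinct term values
(`valuation_sum_eq_sup_of_pairwise_ne`) and is congruent to `a₀` modulo `𝔪_O`: so
`resField O ⊤ = resField O K₀` and the separable generation hypothesis on `K₀` is the claim.
[folklore] -/
theorem stub_abhyankarSepOfNotResidue :
    ∀ p : ℕ, p.Prime → ∀ (k K : Type) [Field k] [CharP k p] [Field K] [Algebra k K] (O : ValuationSubring K) (A₀ : Subalgebra k K) (h₀ : A₀.toSubring ≤ O.toSubring) (t : K), A₀.FG → ∀ (htp : t ^ p ∈ A₀), IsFractionRing (Algebra.adjoin k (insert t (A₀ : Set K))) K → IsRegularLocalRing (Localization.AtPrime (Ideal.comap (Subring.inclusion h₀) (IsLocalRing.maximalIdeal O))) → Literature.AlgebraicGeometry.Resolution.IsAbhyankarPlace O (algebraMap k K).fieldRange ⊤ → Literature.AlgebraicGeometry.Resolution.SeparablyGeneratedOver (Literature.AlgebraicGeometry.Resolution.resField O (algebraMap k K).fieldRange) (Literature.AlgebraicGeometry.Resolution.resField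 O (Subfield.closure (A₀ : Set K))) → ¬ (∃ c g : K, c ∈ Subfield.closure (A₀ : Set K) ∧ g ∈ Subfield.closure (A₀ : Set K) ∧ g ≠ 0 ∧ (t - c) / g ∈ O ∧ ∀ z : K, z ∈ Subfield.closure (A₀ : Set K) → ¬ O.valuation ((t - c) / g - z) < 1) → (∀ c : Localization.AtPrime (Ideal.comap (Subring.inclusion h₀) (IsLocalRing.maximalIdeal O)), algebraMap A₀.toSubring (Localization.AtPrime (Ideal.comap (Subring.inclusion h₀) (IsLocalRing.maximalIdeal O))) ⟨t ^ p, htp⟩ ≠ c ^ p) → Literature.AlgebraicGeometry.Resolution.SeparablyGeneratedOver (Literature.AlgebraicGeometry.Resolution.resField O (algebraMap k K).fieldRange) (Literature.AlgebraicGeometry.Resolution.resField O ⊤) := by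
  classical
  intro p hp k K _ _ _ _ O A₀ h₀ t hfg htp hfr hreg hAK hS₀ hPf hpow
  haveI : CharP K p := charP_of_injective_algebraMap (algebraMap k K).injective p
  -- the type rendering `K₀` of `Frac A₀` and its basic properties
  obtain ⟨hfin, huniq, hset⟩ := torsorExtension_finite_unique p hp k K O A₀ t htp hfr
  haveI := hfin
  have hmemK₀ : ∀ z : K, z ∈ IntermediateField.adjoin k (A₀ : Set K) ↔
      z ∈ Subfield.closure (A₀ : Set K) := fun z => Set.ext_iff.mp hset z
  -- (1) a best approximation `c₀ ∈ K₀` of `t` (defectless + unibranched)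
  have hdef := isDefectlessIn_torsor_of_isAbhyankarPlace p hp k K O A₀ h₀ t hfg htp hfr hAK
  obtain ⟨c₀, hc₀⟩ := exists_forall_valuation_sub_le_of_isDefectlessIn O huniq hdef t
  have hc₀F : (c₀ : K) ∈ Subfield.closure (A₀ : Set K) := (hmemK₀ _).mp c₀.2
  have hmin : ∀ c' : K, c' ∈ Subfield.closure (A₀ : Set K) →
      O.valuation (t - c₀) ≤ O.valuation (t - c') := fun c' hc' =>
    hc₀ ⟨c', (hmemK₀ c').mpr hc'⟩
  -- (2) `t ∉ K₀`, so `u := t - c₀ ≠ 0`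
  haveI := hreg
  have htK₀ : t ∉ Subfield.closure (A₀ : Set K) :=
    dimTwo_not_mem_closure_of_forall_ne_pow hp A₀ t htp
      (IsLocalization.injective (Localization.AtPrime (Ideal.comap (Subring.inclusion h₀)
        (IsLocalRing.maximalIdeal O))) (M := (Ideal.comap (Subring.inclusion h₀)
        (IsLocalRing.maximalIdeal O)).primeCompl) (Ideal.primeCompl_le_nonZeroDivisors _)) hpow
  have hu0 : t - (c₀ : K) ≠ 0 := fun h => htK₀ (by rw [sub_eq_zero.mp h]; exact hc₀F)
  -- (3) `ν(u)` is not a value of `K₀` (no residue exit)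
  have hval : ∀ z : K, z ∈ Subfield.closure (A₀ : Set K) →
      O.valuation (t - c₀) ≠ O.valuation z := by
    intro z hz heq
    by_cases hz0 : z = 0
    · rw [hz0, Valuation.map_zero, Valuation.zero_iff] at heq
      exact hu0 heq
    · refine hPf ⟨c₀, z, hc₀F, hz, hz0, ?_, dimTwo_residue_hyp_of_best O A₀ hc₀F hz hz0 heq hmin⟩
      rw [← O.valuation_le_one_iff, Valuation.map_div, heq,
        div_self ((Valuation.ne_zero_iff _).mpr hz0)]
  have hup : (t - (c₀ : K)) ^ p ∈ IntermediateField.adjoin k (A₀ : Set K) :=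
    torsorExt_pow_mem_adjoin hp A₀ t htp hfr _
  have hupF : ∃ g ∈ Subfield.closure (A₀ : Set K),
      O.valuation ((t - (c₀ : K)) ^ p) = O.valuation g :=
    ⟨(t - (c₀ : K)) ^ p, (hmemK₀ _).mp hup, rfl⟩
  -- (4) `K = K₀(u)` and the residue field of `K` is that of `K₀`
  have htop :
      IntermediateField.adjoin (IntermediateField.adjoin k (A₀ : Set K)) {t - (c₀ : K)} = ⊤ := by
    rw [eq_top_iff, ← torsorExt_adjoin_simple_eq_top A₀ t hfr,
      IntermediateField.adjoin_simple_le_iff]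
    have hmem : t - (c₀ : K) + (c₀ : K) ∈
        IntermediateField.adjoin (IntermediateField.adjoin k (A₀ : Set K)) {t - (c₀ : K)} :=
      add_mem (IntermediateField.mem_adjoin_simple_self _ (t - (c₀ : K)))
        (IntermediateField.algebraMap_mem _ c₀)
    rwa [sub_add_cancel] at hmem
  have hres : resField O ⊤ = resField O (Subfield.closure (A₀ : Set K)) := by
    refine le_antisymm (fun r hr => ?_) (resField_mono O le_top)
    obtain ⟨a, -, rfl⟩ := (mem_resField_iff O ⊤ r).mp hr
    obtain ⟨coef, hcoef⟩ := sepNotRes_exists_sum_eq hp.ne_zero (t - (c₀ : K))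
      (⟨(t - (c₀ : K)) ^ p, hup⟩ : IntermediateField.adjoin k (A₀ : Set K)) rfl (a : K)
      (by rw [htop]; exact IntermediateField.mem_top)
    exact sepNotRes_residue_mem_resField O _ hp hu0 hupF hval (fun i => (coef i : K))
      (fun i => (hmemK₀ _).mp (coef i).2) a hcoef
  rw [hres]
  exact hS₀

end Summit.ResolutionOfSingularities.ResolutionOfSingularities.Theorems.PfaffLine
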